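import Mathlib
import Summits.ValiantsHypothesis.ValiantsHypothesis.Theses.RigidityForcesSymmetry
import Literature.Computability.AlgebraicComplexity.GrenetEquivariant
import Summits.ValiantsHypothesis.ValiantsHypothesis.Theorems.RigidityForcesSymmetryGrenetFirstOrderRankRigidPencil
import Summits.ValiantsHypothesis.ValiantsHypothesis.Theorems.RigidityForcesSymmetryGrenetFirstOrderRankRigidConstGauge
import Summits.ValiantsHypothesis.ValiantsHypothesis.Theorems.RigidityForcesSymmetryGrenetFirstOrderRankRigidBorders
import Summits.ValiantsHypothesis.ValiantsHypothesis.Theorems.RigidityForcesSymmetryGrenetFirstOrderRankRigidBlockIIPQ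

/-!
# Line `grenet_gauge` — crux `RigidityForcesSymmetry.GrenetFirstOrderRankRigid` (stmt-ValiantsHypothesis-21029)

T2 rung of `RankRigidMinimalRepr` (tenure sweep TABLE row 36): GRENET FIRST-ORDER RANK RIGIDITY for all `n ≥ 3`
(= the strategist's sub-crux A1 `TightRankInfRigid`, `Cruxes/RankRigidMinimalRepr/CruxCalibration.lean`; certified
numerically for `n = 3, …, 8`, kit job j025573: constrained tangent = trace-balanced gauge tangent, dimension `2m² - 2`).

The crux is existential in the representation; the line FIXES THE WITNESS to be Grenet's matrix as it already exists in
the tree (`Literature…Grenet.repr ℂ n e`, determinant `= per_n` by `Grenet.isAffineDetRepr_repr`) and splits the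
rigidity claim along the degree filtration of the Jacobi tangency identity `tr(adj(x̃)·x̃') ≡ 0`:

* `stub_pencil` (S, bookkeeping): Grenet's matrix is the affine pencil of its constant part `gΛ n` and its coefficient
  matrices `gA n v` (entries have total degree `≤ 1`).
* `stub_constGauge` (M, linear algebra): the DEGREE-ZERO component of the tangency identity is `tr(adj(gΛ)·Λ') = 0`;
  since `gΛ n` (the `(univ, ∅)`-minor of the identity) has corank exactly one, this is equivalent to `Λ'` being a gauge
  direction `P·gΛ - gΛ·Q`, and the pair can be chosen TRACE-BALANCED (`tr P = tr Q`; the stabiliser of `gΛ` contains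
  pairs of unequal trace), so that subtracting it preserves tangency (`tr(adj x̃ (P x̃ - x̃ Q)) = (tr P - tr Q)·per_n`) and the
  rank constraint (`(P A_v - A_v Q)(ker A_v) ⊆ im A_v`).
* `stub_linearRigid` (L, THE CONTENT): once `Λ'` is a balanced gauge direction, the whole direction is gauge: the
  positive-degree components of `tr(adj(x̃)·Σ_v x_v A''_v) ≡ 0` for a rank-constrained `A''` (`(A''_v)_{ST} = 0` unless
  `S` is a row or `T` a column of the partial permutation matrix `A_v`) force `A''_v = P A_v - A_v Q` with `P gΛ = gΛ Q`.
  Plan for the prover: Jacobi's complementary-minor formula for the unipotent matrix `1 - adj` gives the cofactors of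
  Grenet's matrix explicitly as `adj(x̃)_{T,S} = ±(per_n · W(T→S) - per_S · per^T)` (lattice-path sums `W`, `per_S` the
  permanent of the first `|S|` rows on columns `S`, `per^T` of the last rows on the complement of `T`; the `(∅, univ)`
  entry is the tree's `Grenet.adjugate_one_sub_empty_univ`); the identity then splits over the weights of the two-sided
  torus (which fixes Grenet's pencil up to gauge, `Grenet.isEquivariantDetRepr_repr`), and each weight block is a
  layered linear system on the Boolean lattice solved by induction on the layer.
* `GrenetFirstOrderRankRigid_of`: composition, kernel-checked (witness `(gΛ n, gA n)`; determinant from the tree).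

STATUS (val-width-21029-p1 g0, 2026-08-27): `stub_pencil` and `stub_constGauge` are CLOSED — proved in general-enumeration
form in `Theorems/RigidityForcesSymmetryGrenetFirstOrderRankRigidPencil.lean` (`grenet_pencil_eq`, p576274) and
`Theorems/RigidityForcesSymmetryGrenetFirstOrderRankRigidConstGauge.lean` (`grenet_constGauge`, p576744); the definitions
below unfold to their hypotheses, so each stub is an `exact`.
STATUS (val-width-21029-p1/p2/p3, 2026-08-28): ALL STUBS CLOSED — `stub_linearRigid` is a theorem: the reduction to
homogeneous directions, the allowed entries, the path form of the adjugate, the torus-weight splitting, the blocks W0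
(potentials), III/I< (gap designs), I= (windows), I> (dominated overlap designs), the type-II borders (`(univ, T)` and
`(S, ∅)`), the gluing (`grenet_linearRigid_of_blockII_PQ`) and the type-II interior `stub_blockII` = (D-PQ) for the
pairs `T ⊊ U` (`grenet_blockII_PQ`: permutation designs with one extra cell + the block algebra in characteristic zero)
are theorems (`Theorems/RigidityForcesSymmetryGrenetFirstOrderRankRigid*.lean`); every stub below is an `exact`.

Calibration (honest): OPEN for general `n` but NOT a named conjecture and NOT ≥ any known lower bound — it is a statement
about one explicit matrix family; with the slice lemma A2 and `RankRigidityForcesTorus` (proved) it only calibrates the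
crux `RankRigidMinimalRepr` against the route's target `GrenetLowerBound` (`crux_iff_target`). VP ≠ VNP is not moved.
-/

noncomputable section

set_option linter.dupNamespace false

namespace Summit.ValiantsHypothesis.ValiantsHypothesis.Cruxes.GrenetFirstOrderRankRigid.GrenetGauge

open Literature.Computability.AlgebraicComplexity
open Summit.ValiantsHypothesis.ValiantsHypothesis.Theses.RigidityForcesSymmetry
open Summit.ValiantsHypothesis.Theorems.RigidityForcesSymmetry.GrenetGauge

/-- An enumeration of the vertices of Grenet's branching program (the subsets of `Fin n`) by `Fin (2ⁿ - 1 + 1)`. -/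
def enumSubsets (n : ℕ) : Finset (Fin n) ≃ Fin (2 ^ n - 1 + 1) :=
  Fintype.equivFinOfCardEq (by
    rw [Fintype.card_finset, Fintype.card_fin]
    have := Nat.one_le_two_pow (n := n)
    omega)

/-- Grenet's `(2ⁿ - 1) × (2ⁿ - 1)` affine matrix for `per_n` (tree definition `Grenet.repr`), with the enumeration above. -/
def grenetMatrix (n : ℕ) : Matrix (Fin (2 ^ n - 1)) (Fin (2 ^ n - 1)) (MvPolynomial (Fin n × Fin n) ℂ) :=
  Grenet.repr ℂ n (enumSubsets n)

/-- Constant part `Λ` of Grenet's pencil. -/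
def gΛ (n : ℕ) : Matrix (Fin (2 ^ n - 1)) (Fin (2 ^ n - 1)) ℂ :=
  fun i j => MvPolynomial.coeff 0 (grenetMatrix n i j)

/-- Coefficient matrix `A_v` of the variable `x_v` in Grenet's pencil (a signed partial permutation matrix). -/
def gA (n : ℕ) (v : Fin n × Fin n) : Matrix (Fin (2 ^ n - 1)) (Fin (2 ^ n - 1)) ℂ :=
  fun i j => MvPolynomial.coeff (Finsupp.single v 1) (grenetMatrix n i j)

/-- **Stub 1 (S, bookkeeping).** Grenet's matrix is the affine pencil `Λ + Σ_v x_v A_v` of its constant part and its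
coefficient matrices (every entry has total degree `≤ 1`, `Grenet.isAffineDetRepr_repr`). [cite: Grenet2011, Thm. 1] -/
theorem stub_pencil :
    ∀ n : ℕ, 3 ≤ n →
      (gΛ n).map MvPolynomial.C + ∑ v, (MvPolynomial.X v : MvPolynomial (Fin n × Fin n) ℂ) • (gA n v).map MvPolynomial.C
        = grenetMatrix n := by
  intro n hn
  have hN : 2 ^ n = 2 ^ n - 1 + 1 := by
    have := Nat.one_le_two_pow (n := n)
    omega
  exact grenet_pencil_eq n (by omega) hN (enumSubsets n)

/-- **Stub 2 (M).** Degree-zero part of the tangency identity + corank-one gauge lemma, trace-balanced: if `(Λ', A')` is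
Zariski-tangent to `{det = per_n}` at Grenet's pencil then `Λ' = P·Λ - Λ·Q` for some `P, Q` with `tr P = tr Q`. [folklore] -/
theorem stub_constGauge :
    ∀ n : ℕ, 3 ≤ n →
      ∀ (Λ' : Matrix (Fin (2 ^ n - 1)) (Fin (2 ^ n - 1)) ℂ) (A' : Fin n × Fin n → Matrix (Fin (2 ^ n - 1)) (Fin (2 ^ n - 1)) ℂ),
        (((gΛ n).map MvPolynomial.C + ∑ v, (MvPolynomial.X v : MvPolynomial (Fin n × Fin n) ℂ) • (gA n v).map MvPolynomial.C).adjugate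
            * (Λ'.map MvPolynomial.C + ∑ v, (MvPolynomial.X v : MvPolynomial (Fin n × Fin n) ℂ) • (A' v).map MvPolynomial.C)).trace
          = (0 : MvPolynomial (Fin n × Fin n) ℂ) →
        ∃ P Q : Matrix (Fin (2 ^ n - 1)) (Fin (2 ^ n - 1)) ℂ, P.trace = Q.trace ∧ Λ' = P * gΛ n - gΛ n * Q := by
  intro n hn Λ' A' htr
  exact grenet_constGauge (enumSubsets n) (by omega) (fun _ _ => rfl) (gA n) Λ' A' htr

/-- **Stub 3' (the remaining content): (D-PQ) for the interior of the overlap blocks of type II.**  For a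
homogeneous direction `Σ_v x_v A'_v` that is Zariski-tangent at Grenet's pencil and supported on the tail/head
positions (rows `R i = e⁻¹((e univ).succAbove i)`, columns `C j = e⁻¹((e ∅).succAbove j)`, `e = enumSubsets n`): a
genuine tail entry `(i, j, v)` and a genuine head entry `(i', j', v')` of the same pair `(U, T) = (R i + v.1, C j)`,
`C j = C j' - v'.1`, with `T ⊆ U`, satisfy `A'_{v'} i' j' = - A'_v i j`.  (Blueprint §5, block II: permutation designs
with one extra cell; val-width-21029-p2.) [cite: Grenet2011, Thm. 1] -/
theorem stub_blockII :
    ∀ n : ℕ, 3 ≤ n → ∀ (A' : Fin n × Fin n → Matrix (Fin (2 ^ n - 1)) (Fin (2 ^ n - 1)) ℂ),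
      ((grenetMatrix n).adjugate * ∑ v, (MvPolynomial.X v : MvPolynomial (Fin n × Fin n) ℂ) • (A' v).map MvPolynomial.C).trace
          = (0 : MvPolynomial (Fin n × Fin n) ℂ) →
      (∀ (w : Fin n × Fin n) (a b : Fin (2 ^ n - 1)), A' w a b ≠ 0 →
        (w.1 ∉ (enumSubsets n).symm ((enumSubsets n Finset.univ).succAbove a) ∧
            (w.2 : ℕ) = ((enumSubsets n).symm ((enumSubsets n Finset.univ).succAbove a)).card) ∨
          (w.1 ∈ (enumSubsets n).symm ((enumSubsets n ∅).succAbove b) ∧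
            ((enumSubsets n).symm ((enumSubsets n ∅).succAbove b)).card = (w.2 : ℕ) + 1)) →
      ∀ (i j : Fin (2 ^ n - 1)) (v : Fin n × Fin n) (i' j' : Fin (2 ^ n - 1)) (v' : Fin n × Fin n),
        (v.1 ∉ (enumSubsets n).symm ((enumSubsets n Finset.univ).succAbove i) ∧
            (v.2 : ℕ) = ((enumSubsets n).symm ((enumSubsets n Finset.univ).succAbove i)).card) →
        ¬ (v.1 ∈ (enumSubsets n).symm ((enumSubsets n ∅).succAbove j) ∧
            ((enumSubsets n).symm ((enumSubsets n ∅).succAbove j)).card = (v.2 : ℕ) + 1) →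
        (v'.1 ∈ (enumSubsets n).symm ((enumSubsets n ∅).succAbove j') ∧
            ((enumSubsets n).symm ((enumSubsets n ∅).succAbove j')).card = (v'.2 : ℕ) + 1) →
        ¬ (v'.1 ∉ (enumSubsets n).symm ((enumSubsets n Finset.univ).succAbove i') ∧
            (v'.2 : ℕ) = ((enumSubsets n).symm ((enumSubsets n Finset.univ).succAbove i')).card) →
        insert v.1 ((enumSubsets n).symm ((enumSubsets n Finset.univ).succAbove i))
            = (enumSubsets n).symm ((enumSubsets n Finset.univ).succAbove i') →
        (enumSubsets n).symm ((enumSubsets n ∅).succAbove j)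
            = ((enumSubsets n).symm ((enumSubsets n ∅).succAbove j')).erase v'.1 →
        (enumSubsets n).symm ((enumSubsets n ∅).succAbove j) ⊆ (enumSubsets n).symm ((enumSubsets n Finset.univ).succAbove i') →
        A' v' i' j' = -A' v i j := by
  intro n hn A' htr hsupp i j v i' j' v' ht hnh hh hnt hU hT hsub
  have hN : 2 ^ n = 2 ^ n - 1 + 1 := by
    have := Nat.one_le_two_pow (n := n)
    omega
  exact grenet_blockII_PQ (enumSubsets n) (by omega) hN A' htr hsupp i j v i' j' v' ht hnh hh hnt hU hT hsub

/-- **Stub 3 (L), now a consequence of Stub 3'.** Linear rigidity: a rank-constrained tangent direction whose constant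
part is a trace-balanced gauge direction is a gauge direction (`grenet_linearRigid_of_blockII_PQ` + `stub_blockII`).
Certified for `n = 3..8` (kit j025573). [cite: Grenet2011, Thm. 1] -/
theorem stub_linearRigid :
    ∀ n : ℕ, 3 ≤ n →
      ∀ (Λ' : Matrix (Fin (2 ^ n - 1)) (Fin (2 ^ n - 1)) ℂ) (A' : Fin n × Fin n → Matrix (Fin (2 ^ n - 1)) (Fin (2 ^ n - 1)) ℂ),
        (((gΛ n).map MvPolynomial.C + ∑ v, (MvPolynomial.X v : MvPolynomial (Fin n × Fin n) ℂ) • (gA n v).map MvPolynomial.C).adjugate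
            * (Λ'.map MvPolynomial.C + ∑ v, (MvPolynomial.X v : MvPolynomial (Fin n × Fin n) ℂ) • (A' v).map MvPolynomial.C)).trace
          = (0 : MvPolynomial (Fin n × Fin n) ℂ) →
        (∀ v w, (gA n v).mulVec w = 0 → ∃ u, (A' v).mulVec w = (gA n v).mulVec u) →
        (∃ P Q : Matrix (Fin (2 ^ n - 1)) (Fin (2 ^ n - 1)) ℂ, P.trace = Q.trace ∧ Λ' = P * gΛ n - gΛ n * Q) →
        ∃ P Q : Matrix (Fin (2 ^ n - 1)) (Fin (2 ^ n - 1)) ℂ,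
          Λ' = P * gΛ n - gΛ n * Q ∧ ∀ v, A' v = P * gA n v - gA n v * Q := by
  intro n hn Λ' A' htr hC h3
  have hN : 2 ^ n = 2 ^ n - 1 + 1 := by
    have := Nat.one_le_two_pow (n := n)
    omega
  exact grenet_linearRigid_of_blockII_PQ (enumSubsets n) (by omega) hN (stub_blockII n hn) Λ' A' htr hC h3

/-- **Composition (kernel-checked).** Witness: Grenet's pencil; determinant from the tree. [cite: Grenet2011, Thm. 1] -/
theorem GrenetFirstOrderRankRigid_of : GrenetFirstOrderRankRigid := by
  intro n hn
  refine ⟨gΛ n, gA n, ?_, ?_⟩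
  · rw [stub_pencil n hn]
    have hN : 2 ^ n = 2 ^ n - 1 + 1 := by
      have := Nat.one_le_two_pow (n := n)
      omega
    exact (Grenet.isAffineDetRepr_repr ℂ n (by omega) hN (enumSubsets n)).2
  · intro Λ' A' htr hC
    exact stub_linearRigid n hn Λ' A' htr hC (stub_constGauge n hn Λ' A' htr)

end Summit.ValiantsHypothesis.ValiantsHypothesis.Cruxes.GrenetFirstOrderRankRigid.GrenetGauge
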